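import Summits.QuantumFields.YangMills.Theorems.PencilRigidityWeakCouplingHypercubicLimitRPSwapPairingPSD
import Summits.QuantumFields.YangMills.Theorems.MirrorModularBoostsHypercubicLimitConvergenceSubseq
import Summits.QuantumFields.YangMills.Theorems.MirrorModularBoostsHypercubicLimitPlaneSumE0E3
import Summits.QuantumFields.YangMills.Theorems.PencilRigidityWeakCouplingHypercubicLimitSignedPerm
import HarnessLib

/-!
# Crux `WeakCouplingHypercubicLimitRP` (stmt-QuantumFields-27398), line `Sketch`, stub D1 `stub_diagRPOfPlaneLimits`:
# the TRANSFER through the own-torus swap socket (file 2 of 2: frame reduction, closure, the D1 corollary)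

Helper file (`--supports stmt-QuantumFields-27398`) of the crux lead `lead-27398-D1` for the registered stub D1
`stub_diagRPOfPlaneLimits` of `Cruxes/WeakCouplingHypercubicLimitRP/Lines/Sketch.lean` (sha16 `7bf38c709623ad77`):
`… → PlaneLimits r sch φ T → DiagonalFrameRP (planeSum T)` — diagonal-frame reflection positivity of the constructed
plane-limit family of the witness scheme.  File 1 (`…WeakCouplingHypercubicLimitRPSwapPairingPSD.lean`) proves (PSD) in a
canonical frame from the own-torus swap socket (`RpClosure.psd_canonical_ofSwapPairing`).

HONEST FRAMING.  Nothing here closes D1, the crux ⟨27398⟩ or its heart S6i; the Yang–Mills mass gap is NOT proved here or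
anywhere in the tree.  What is proved is the CONTINUUM HALF of D1, unconditionally: D1 follows from the LATTICE statement
D1′ «the swap-mirror Gram pairings of compact half-space curvature products on the witness's OWN odd tori have
`liminf_k ≥ 0` along the subsequence» — the socket `OddTorusSwapPairingLiminf r (subseq sch φ hφ)` of the door-B core
(`Cruxes/DiagonalMirrorRPR/Lines/sign_twisted_diagonal_trace_core.lean`, concluded there by `core_of` from the letters
`OddTwistGap`/`DiagLukewarm`/`Growth`) and equally of door C (`pairingLiminf_of_cube`).  The socket's body is stated VERBATIM
as a hypothesis (its `def` lives in a `Cruxes/` workfile, not importable under `Theorems/`).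

## Contents

* §3 Frame reduction by proper sign flips (`psd_frame_ofSwapPairing`, needs only the PROPER `W(B₄)` clause) and the density
  closure (`isReflectionPositive_pullback_ofSwapPairing`) — the landed `RpClosure.psd_frame` / `isReflectionPositive_pullback`
  (p87246–p94527) verbatim with the new (PSD) input of file 1; `diagonalFrameRP_of_swapPairingLiminf` packages
  `hconv + E0 + proper W(B₄) + socket ⇒ DiagonalFrameRP`.
* §4 Corollaries.  (a) `diagonalFrameRP_of_curvaturePackage_of_swapPairingLiminf`: the door-B core's size-M `stub_closure`
  shape `CurvaturePackage r sch S₁ → socket → DiagonalFrameRP S₁` (read `hconv`, E0, `W(B₄)` off the package).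
  (b) **`diagRPOfPlaneLimits_of_swapPairingLiminf`** (the D1 transfer): `UniformFunctionalBoundPlanes r sch → PlaneLimits r sch φ T →
  socket for (r, subseq sch φ hφ) → DiagonalFrameRP (planeSum T)`, with `hconv` along `φ` from `convergence_subseq_of_planeLimits`,
  E0 from `planeSum_isNormalized_isSymmetric`, signed permutations from `stub_signedPermOfPlaneLimits`.  So the registered D1
  reduces to D1′ «D1's hypotheses ⇒ the socket for `(r, subseq sch φ hφ)`», a statement about Wilson's measure on the witness's
  own tori.

References: Osterwalder–Schrader, Comm. Math. Phys. 31 (1973) §2–3 (E2 on `𝒮_<`); Osterwalder–Seiler, Ann. Phys. 110 (1978)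
§2–3; Fröhlich–Israel–Lieb–Simon, Comm. Math. Phys. 62 (1978) Thm 2.1; Glimm–Jaffe, *Quantum Physics* §6.1.
-/

set_option autoImplicit false

noncomputable section

open scoped SchwartzMap ComplexConjugate InnerProductSpace
open MeasureTheory Filter Topology
open Literature.MathematicalPhysics.QuantumLattice Literature.MathematicalPhysics.AQFT
  Literature.MathematicalPhysics.QuantumFieldTheory
open Literature.Probability.LatticeModels (box Site)

namespace Summit.QuantumFields.YangMills.Cruxes.DiagonalMirrorRPR.ParityBridgeColdTraces

namespace RpClosure

/-! ## §3 Frame reduction and the density closure (the landed §I with the new (PSD) input) -/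

section Closure

variable {G : Type} [Group G] [TopologicalSpace G] [IsTopologicalGroup G] [CompactSpace G]
  [MeasurableSpace G] [BorelSpace G] (r : LatticeRep G) (sch : SpeciesScheme (YMSpecies G))
  (S₁ : SchwingerFamily E4)

/-- **(PSD) in every diagonal frame, from the socket**: reduce `R` to a canonical frame by a proper sign flip `P`
(`frame_normal_form`; `𝔖(PR · G) = 𝔖(R · G)` for the off-diagonal `G = Θ P_I* ⊗ P_J` by the PROPER `W(B₄)`-invariance
`hrot` on `⁰𝒮`), then `psd_canonical_ofSwapPairing`. -/
theorem psd_frame_ofSwapPairing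
    (hconv : ∀ (n : ℕ), n ≠ 0 → ∀ (f : Fin n → 𝓢(E4, ℝ)) (F : 𝓢((Fin n → E4), ℂ)),
      IsTensorOf F (fun i => ofRealTest (f i)) → IsOffDiagonal F →
        Tendsto (fun k : ℕ => ((latticeSchwinger r.ρ sch (fun s => s.F) k n (fun _ => r.curvature) f : ℝ) : ℂ))
          atTop (𝓝 (S₁ n F)))
    (hE0 : S₁.toLabelled.IsNormalized)
    (hrot : ∀ (L : E4 ≃ₗᵢ[ℝ] E4), LinearMap.det (L.toLinearEquiv : E4 →ₗ[ℝ] E4) = 1 →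
      (∀ i : Fin 4, ∃ j : Fin 4, L (EuclideanSpace.single i 1) = EuclideanSpace.single j 1 ∨
        L (EuclideanSpace.single i 1) = -EuclideanSpace.single j 1) →
      ∀ (n : ℕ) (F : 𝓢((Fin n → E4), ℂ)), IsOffDiagonal F → S₁ n (linActMulti L F) = S₁ n F)
    (hsock : ∀ (m : ℕ) (n : Fin m → ℕ) (c : Fin m → ℝ) (f σf : (i : Fin m) → Fin (n i) → 𝓢(E4, ℝ)),
      (∀ i j, HasCompactSupport (f i j : E4 → ℝ) ∧ tsupport (f i j : E4 → ℝ) ⊆ {x : E4 | x 1 < x 0}) →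
      (∀ i (j j' : Fin (n i)), j ≠ j' → Disjoint (tsupport (f i j : E4 → ℝ)) (tsupport (f i j' : E4 → ℝ))) →
      (∀ i j (x : E4), σf i j x = f i (Fin.rev j) (swap01 x)) →
        0 ≤ Filter.liminf (fun k : ℕ => ∑ i, ∑ i', c i * c i' *
          latticeSchwinger r.ρ sch (fun s => s.F) k (n i + n i') (fun _ => r.curvature)
            (Fin.append (σf i) (f i'))) atTop)
    {R : E4 ≃ₗᵢ[ℝ] E4} {a b : ℝ} (ha : a ^ 2 = 1 / 2) (hb : b ^ 2 = 1 / 2)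
    (hR : R (ee 0) = a • ee 0 + b • ee 1) {ι : Type} [Fintype ι] (deg : ι → ℕ)
    (P : (I : ι) → 𝓢((Fin (deg I) → E4), ℂ)) (hP : ∀ I, P I ∈ slabOrderedCompactProducts 4 (deg I))
    (coef : ι → ℂ) :
    let z := ∑ I, ∑ J, conj (coef I) * coef J * (pullback S₁ R).osPairing (P I) (P J)
    0 ≤ z.re ∧ z.im = 0 := by
  -- adapted from `psd_frame` (…StubRpClosure §I)
  intro z
  obtain ⟨Pf, c, hc, hc0, hdet, hsigned, hR'⟩ := frame_normal_form ha hb hR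
  have hterm : ∀ I J, (pullback S₁ R).osPairing (P I) (P J) =
      (pullback S₁ (R.trans Pf)).osPairing (P I) (P J) := by
    intro I J
    obtain ⟨fI, loI, hiI, hTI, hloI, hleI, hordI, hsuppI, -⟩ := hP I
    obtain ⟨fJ, loJ, hiJ, hTJ, hloJ, hleJ, hordJ, hsuppJ, -⟩ := hP J
    obtain ⟨LO, HI, -, hord', hsupp'⟩ := append_slabs hloI hleI hordI hsuppI hloJ hleJ hordJ hsuppJ
    have hoff : IsOffDiagonal ((osAdjoint (P I)).appendTensor (P J)) :=
      isOffDiagonal_of_slabs (isTensorOf_osAdjoint_appendTensor hTI hTJ) hord' hsupp'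
    rw [pullback_osPairing, pullback_osPairing,
      ← Summit.QuantumFields.YangMills.Theorems.DiagonalMirrorRPR.Negative.Phantom.linActMulti_linActMulti Pf R,
      hrot Pf hdet hsigned _ _ (isOffDiagonal_linActMulti hoff R)]
  simp only [z, hterm]
  exact psd_canonical_ofSwapPairing r sch S₁ hconv hE0 hsock hc hc0 hR' deg P hP coef

/-- **The closure step, from the socket.**  Own-torus convergence `hconv` + E0 + the proper `W(B₄)`-invariance on `⁰𝒮` +
the own-torus swap socket (real coefficients, `liminf ≥ 0`) + continuity of `S₁ n` + density of slab-ordered compact real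
products in the time-ordered test functions ⇒ the pulled-back family is reflection positive (E2) in the diagonal frame `R`. -/
theorem isReflectionPositive_pullback_ofSwapPairing
    (hconv : ∀ (n : ℕ), n ≠ 0 → ∀ (f : Fin n → 𝓢(E4, ℝ)) (F : 𝓢((Fin n → E4), ℂ)),
      IsTensorOf F (fun i => ofRealTest (f i)) → IsOffDiagonal F →
        Tendsto (fun k : ℕ => ((latticeSchwinger r.ρ sch (fun s => s.F) k n (fun _ => r.curvature) f : ℝ) : ℂ))
          atTop (𝓝 (S₁ n F)))
    (hE0 : S₁.toLabelled.IsNormalized)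
    (hrot : ∀ (L : E4 ≃ₗᵢ[ℝ] E4), LinearMap.det (L.toLinearEquiv : E4 →ₗ[ℝ] E4) = 1 →
      (∀ i : Fin 4, ∃ j : Fin 4, L (EuclideanSpace.single i 1) = EuclideanSpace.single j 1 ∨
        L (EuclideanSpace.single i 1) = -EuclideanSpace.single j 1) →
      ∀ (n : ℕ) (F : 𝓢((Fin n → E4), ℂ)), IsOffDiagonal F → S₁ n (linActMulti L F) = S₁ n F)
    (hsock : ∀ (m : ℕ) (n : Fin m → ℕ) (c : Fin m → ℝ) (f σf : (i : Fin m) → Fin (n i) → 𝓢(E4, ℝ)),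
      (∀ i j, HasCompactSupport (f i j : E4 → ℝ) ∧ tsupport (f i j : E4 → ℝ) ⊆ {x : E4 | x 1 < x 0}) →
      (∀ i (j j' : Fin (n i)), j ≠ j' → Disjoint (tsupport (f i j : E4 → ℝ)) (tsupport (f i j' : E4 → ℝ))) →
      (∀ i j (x : E4), σf i j x = f i (Fin.rev j) (swap01 x)) →
        0 ≤ Filter.liminf (fun k : ℕ => ∑ i, ∑ i', c i * c i' *
          latticeSchwinger r.ρ sch (fun s => s.F) k (n i + n i') (fun _ => r.curvature)
            (Fin.append (σf i) (f i'))) atTop)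
    {R : E4 ≃ₗᵢ[ℝ] E4} {a b : ℝ} (ha : a ^ 2 = 1 / 2) (hb : b ^ 2 = 1 / 2)
    (hR : R (ee 0) = a • ee 0 + b • ee 1) :
    (SchwingerFamily.toLabelled (fun n => (S₁ n).comp (linActMulti R))).IsReflectionPositive := by
  -- adapted from `isReflectionPositive_pullback` (…StubRpClosure §I), itself adapted from
  -- `IsSchwingerFamilyOf.isOSReflectionPositive_of_closure` (Literature/QuantumLattice/SchwingerOSPositivity)
  intro N deg lab F hF H hH z
  let S : SchwingerFamily E4 := pullback S₁ R
  let Φ : ((j : Fin N) → 𝓢((Fin (deg j) → E4), ℂ)) → ℂ := fun G => ∑ i, ∑ j, S.osPairing (G i) (G j)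
  have hΦ : Continuous Φ := by
    refine continuous_finsetSum _ fun i _ => continuous_finsetSum _ fun j _ => ?_
    exact continuous_iff_continuousAt.2 fun G =>
      S.tendsto_osPairing ((continuous_apply i).tendsto G) ((continuous_apply j).tendsto G)
  let C : Set ℂ := {w | 0 ≤ w.re ∧ w.im = 0}
  have hC : IsClosed C :=
    (isClosed_le continuous_const Complex.continuous_re).inter
      (isClosed_eq Complex.continuous_im continuous_const)
  let A : Set ((j : Fin N) → 𝓢((Fin (deg j) → E4), ℂ)) :=
    Set.pi Set.univ fun j => (Submodule.span ℂ (slabOrderedCompactProducts 4 (deg j)) : Set _)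
  have hA : A ⊆ Φ ⁻¹' C := by
    intro G hG
    have hrep : ∀ j : Fin N, ∃ (k : ℕ) (cf : Fin k → ℂ) (v : Fin k → slabOrderedCompactProducts 4 (deg j)),
        ∑ i, cf i • (v i : 𝓢((Fin (deg j) → E4), ℂ)) = G j :=
      fun j => Submodule.mem_span_set'.1 (hG j (Set.mem_univ j))
    choose k cf v hv using hrep
    have key := psd_frame_ofSwapPairing r sch S₁ hconv hE0 hrot hsock ha hb hR (ι := Σ j : Fin N, Fin (k j))
      (fun p => deg p.1) (fun p => (v p.1 p.2 : 𝓢((Fin (deg p.1) → E4), ℂ))) (fun p => (v p.1 p.2).2)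
      (fun p => cf p.1 p.2)
    have hΦG : Φ G = ∑ p : (Σ j : Fin N, Fin (k j)), ∑ q : (Σ j : Fin N, Fin (k j)),
        conj (cf p.1 p.2) * cf q.1 q.2 *
          S.osPairing (v p.1 p.2 : 𝓢((Fin (deg p.1) → E4), ℂ)) (v q.1 q.2 : 𝓢((Fin (deg q.1) → E4), ℂ)) := by
      simp only [Φ, ← hv]
      simp only [Fintype.sum_sigma]
      refine Finset.sum_congr rfl fun n _ => ?_
      rw [Finset.sum_comm]
      refine Finset.sum_congr rfl fun m _ => ?_
      have := S.osPairing_sum_smul Finset.univ Finset.univ (cf n) (cf m)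
        (fun i => (v n i : 𝓢((Fin (deg n) → E4), ℂ))) (fun i => (v m i : 𝓢((Fin (deg m) → E4), ℂ)))
      rw [this]
    show Φ G ∈ C
    rw [hΦG]
    exact key
  have hcl : closure A ⊆ Φ ⁻¹' C := (hC.preimage hΦ).closure_subset_iff.2 hA
  have hFmem : (fun j : Fin N => F j) ∈ closure A := by
    rw [closure_pi_set]
    exact fun j _ => mem_closure_span_slabOrderedCompactProducts (hF j)
  have hres : Φ (fun j => F j) ∈ C := hcl hFmem
  have hz : z = Φ (fun j => F j) := by
    simp only [z, Φ, SchwingerFamily.toLabelled_apply]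
    refine Finset.sum_congr rfl fun i _ => Finset.sum_congr rfl fun j _ => ?_
    exact S.osPairing_eq_of_isAppendTensorOf (hH i j)
  rw [hz]
  exact hres

/-- **Closure theorem (generic form).**  For a family `S₁` with own-torus convergence on off-diagonal real tensors in all
degrees, E0, and PROPER `W(B₄)`-invariance on `⁰𝒮`, the own-torus swap socket (swap-mirror Gram pairings of compact half-space
curvature products, real coefficients, `liminf ≥ 0`) gives reflection positivity in pull-back form in every diagonal frame
`R e₀ = a e₀ + b e₁`, `a² = b² = ½` (`DiagonalFrameRP S₁`). -/
theorem diagonalFrameRP_of_swapPairingLiminf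
    (hconv : ∀ (n : ℕ), n ≠ 0 → ∀ (f : Fin n → 𝓢(E4, ℝ)) (F : 𝓢((Fin n → E4), ℂ)),
      IsTensorOf F (fun i => ofRealTest (f i)) → IsOffDiagonal F →
        Tendsto (fun k : ℕ => ((latticeSchwinger r.ρ sch (fun s => s.F) k n (fun _ => r.curvature) f : ℝ) : ℂ))
          atTop (𝓝 (S₁ n F)))
    (hE0 : S₁.toLabelled.IsNormalized)
    (hrot : ∀ (L : E4 ≃ₗᵢ[ℝ] E4), LinearMap.det (L.toLinearEquiv : E4 →ₗ[ℝ] E4) = 1 →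
      (∀ i : Fin 4, ∃ j : Fin 4, L (EuclideanSpace.single i 1) = EuclideanSpace.single j 1 ∨
        L (EuclideanSpace.single i 1) = -EuclideanSpace.single j 1) →
      ∀ (n : ℕ) (F : 𝓢((Fin n → E4), ℂ)), IsOffDiagonal F → S₁ n (linActMulti L F) = S₁ n F)
    (hsock : ∀ (m : ℕ) (n : Fin m → ℕ) (c : Fin m → ℝ) (f σf : (i : Fin m) → Fin (n i) → 𝓢(E4, ℝ)),
      (∀ i j, HasCompactSupport (f i j : E4 → ℝ) ∧ tsupport (f i j : E4 → ℝ) ⊆ {x : E4 | x 1 < x 0}) →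
      (∀ i (j j' : Fin (n i)), j ≠ j' → Disjoint (tsupport (f i j : E4 → ℝ)) (tsupport (f i j' : E4 → ℝ))) →
      (∀ i j (x : E4), σf i j x = f i (Fin.rev j) (swap01 x)) →
        0 ≤ Filter.liminf (fun k : ℕ => ∑ i, ∑ i', c i * c i' *
          latticeSchwinger r.ρ sch (fun s => s.F) k (n i + n i') (fun _ => r.curvature)
            (Fin.append (σf i) (f i'))) atTop) :
    DiagonalFrameRP S₁ :=
  fun _R _a _b ha hb hR => isReflectionPositive_pullback_ofSwapPairing r sch S₁ hconv hE0 hrot hsock ha hb hR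

/-! ## §4 Corollaries: the door-B core's closure shape, and the D1 transfer -/

/-- **The door-B core's `stub_closure` shape** (`Cruxes/DiagonalMirrorRPR/Lines/sign_twisted_diagonal_trace_core.lean` §7,
size M): the curvature package `W₁ r sch S₁` (`CurvaturePackage`: `hconv` on the own torus in all degrees, E0, proper
`W(B₄)`-invariance on `⁰𝒮`) and the own-torus swap socket `OddTorusSwapPairingLiminf r sch` (its body verbatim) give
`DiagonalFrameRP S₁`. -/
theorem diagonalFrameRP_of_curvaturePackage_of_swapPairingLiminf (hW : CurvaturePackage r sch S₁)
    (hsock : ∀ (m : ℕ) (n : Fin m → ℕ) (c : Fin m → ℝ) (f σf : (i : Fin m) → Fin (n i) → 𝓢(E4, ℝ)),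
      (∀ i j, HasCompactSupport (f i j : E4 → ℝ) ∧ tsupport (f i j : E4 → ℝ) ⊆ {x : E4 | x 1 < x 0}) →
      (∀ i (j j' : Fin (n i)), j ≠ j' → Disjoint (tsupport (f i j : E4 → ℝ)) (tsupport (f i j' : E4 → ℝ))) →
      (∀ i j (x : E4), σf i j x = f i (Fin.rev j) (swap01 x)) →
        0 ≤ Filter.liminf (fun k : ℕ => ∑ i, ∑ i', c i * c i' *
          latticeSchwinger r.ρ sch (fun s => s.F) k (n i + n i') (fun _ => r.curvature)
            (Fin.append (σf i) (f i'))) atTop) :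
    DiagonalFrameRP S₁ := by
  obtain ⟨hconv, ⟨hE0, -, -, -, -, -⟩, -, hrot, -⟩ := hW
  exact diagonalFrameRP_of_swapPairingLiminf r sch S₁ hconv hE0 hrot hsock

end Closure

end RpClosure

end Summit.QuantumFields.YangMills.Cruxes.DiagonalMirrorRPR.ParityBridgeColdTraces

/-! ### The D1 transfer (crux `WeakCouplingHypercubicLimitRP`, line `Sketch`, stub `stub_diagRPOfPlaneLimits`) -/

namespace Summit.QuantumFields.YangMills.Theorems.WeakCouplingHypercubicLimit.TraceNormColdPressure

open Summit.QuantumFields.YangMills.Cruxes.HypercubicLimit.CouplingResponse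
open Summit.QuantumFields.YangMills.Cruxes.DiagonalMirrorRPR.ParityBridgeColdTraces (E4 DiagonalFrameRP)
open Summit.QuantumFields.YangMills.Cruxes.DiagonalMirrorRPR.ParityBridgeColdTraces.RpClosure (swap01)

/-- **D1 transfer — `stub_diagRPOfPlaneLimits` follows from the own-torus swap socket on the witness.**  For every compact
group `G`, lattice representation `r`, scheme `sch`, strictly increasing `φ` and plane-limit family `T` with
`UniformFunctionalBoundPlanes r sch` and `PlaneLimits r sch φ T`: if along the SUB-SCHEME `subseq sch φ hφ` the swap-mirror
Gram pairings of compact half-space curvature products on the scheme's own odd tori have `liminf ≥ 0` (the socket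
`OddTorusSwapPairingLiminf r (subseq sch φ hφ)` of the door-B core / door C, body verbatim), then the candidate one-field
family `planeSum T` is reflection positive in pull-back form in every diagonal frame (`DiagonalFrameRP (planeSum T)`).
Ingredients: `hconv` along `φ` (`convergence_subseq_of_planeLimits`), E0 (`planeSum_isNormalized_isSymmetric`), signed
permutations on `⁰𝒮` (`stub_signedPermOfPlaneLimits`), and `diagonalFrameRP_of_swapPairingLiminf`.  So the registered D1
reduces to D1′ «D1's hypotheses ⇒ the socket for `(r, subseq sch φ hφ)`», a statement about Wilson's measure on the
witness's own tori; nothing about `RPSpectral`, weak coupling or `PolyVolume`/`PolyRenorm` is used in this half. -/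
theorem diagRPOfPlaneLimits_of_swapPairingLiminf :
    ∀ (G : Type) [Group G] [TopologicalSpace G] [IsTopologicalGroup G] [CompactSpace G]
      [MeasurableSpace G] [BorelSpace G] (r : LatticeRep G) (sch : SpeciesScheme (YMSpecies G))
      (φ : ℕ → ℕ) (hφ : StrictMono φ)
      (T : (n : ℕ) → (Fin n → Plane) → (𝓢((Fin n → EuclideanSpace ℝ (Fin 4)), ℂ) →L[ℂ] ℂ)),
      UniformFunctionalBoundPlanes r sch → PlaneLimits r sch φ T →
        (∀ (m : ℕ) (n : Fin m → ℕ) (c : Fin m → ℝ) (f σf : (i : Fin m) → Fin (n i) → 𝓢(E4, ℝ)),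
          (∀ i j, HasCompactSupport (f i j : E4 → ℝ) ∧ tsupport (f i j : E4 → ℝ) ⊆ {x : E4 | x 1 < x 0}) →
          (∀ i (j j' : Fin (n i)), j ≠ j' → Disjoint (tsupport (f i j : E4 → ℝ)) (tsupport (f i j' : E4 → ℝ))) →
          (∀ i j (x : E4), σf i j x = f i (Fin.rev j) (swap01 x)) →
            0 ≤ Filter.liminf (fun k : ℕ => ∑ i, ∑ i', c i * c i' *
              latticeSchwinger r.ρ (subseq sch φ hφ) (fun s => s.F) k (n i + n i') (fun _ => r.curvature)
                (Fin.append (σf i) (f i'))) atTop) →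
        DiagonalFrameRP (planeSum T) := by
  intro G _ _ _ _ _ _ r sch φ hφ T hUFB hPL hsock
  refine Summit.QuantumFields.YangMills.Cruxes.DiagonalMirrorRPR.ParityBridgeColdTraces.RpClosure.diagonalFrameRP_of_swapPairingLiminf
    r (subseq sch φ hφ) (planeSum T) ?_ ?_ ?_ hsock
  · exact convergence_subseq_of_planeLimits G r sch φ hφ T hPL
  · exact (planeSum_isNormalized_isSymmetric G r sch φ T hPL).1
  · intro L _hdet hsigned n F hF
    exact stub_signedPermOfPlaneLimits G r sch φ hφ T hUFB hPL n L hsigned F hF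

end Summit.QuantumFields.YangMills.Theorems.WeakCouplingHypercubicLimit.TraceNormColdPressure

end
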